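import Summits.Schanuel.Schanuel.Theses.RoyCriterion
import Literature.Barriers.Schanuel.LargeTranscendenceDegreeSmallTrdegProofs
import Literature.Barriers.Schanuel.NesterenkoModularScope
import Literature.Barriers.Schanuel.AlgebraicIndependenceOfLogarithms

-- `Summit.Schanuel.Schanuel.…` is the mandated layout of this single-problem summit (CONVENTIONS §1).
set_option linter.dupNamespace false

/-!
# Route `RoyCriterion`, crux `SchanuelTwo` (stmt-Schanuel-0069) — what line `Sketch` proves, and why its residual stub is the crux

`SchanuelTwo` (`Summit.Schanuel.Schanuel.Theses.RoyCriterion.SchanuelTwo`) is Schanuel's conjecture for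
`n = 2`: for `x : Fin 2 → ℂ` linearly independent over `ℚ`, `2 ≤ trdeg_ℚ ℚ(x, e^x)` (Lang 1966;
Waldschmidt 2000, §1.4; open). Line `Sketch` of the crux chain (idea `hl-collapse-line-purity`) runs:
Hermite–Lindemann collapse ⟹ the crux reduces to pairs of *depth-one seeds* (`trdeg ℚ(a, e^a) = 1`) ⟹
"line purity" sector by sector in the seed types. This support file lands, sorry-free and WITHOUT
definitions, the part of the line that is provable and reusable by later seats of this crux:

* §1 `schanuelTwo_one_le_trdeg_seed`, `schanuelTwo_one_le_trdeg` — the Hermite–Lindemann floor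
  (`trdeg ≥ 1` for one non-zero point / for a `ℚ`-free pair; tree theorem `transcendental_exp_holds`);
  `schanuelTwo_iff_trdeg_ne_one` — the crux says exactly "the transcendence degree is never `1`".
* §2 `schanuelTwo_iff_seedPurity` — **the line's residual stub is equivalent to the crux**: `SchanuelTwo`
  ⟺ purity for `ℚ`-free pairs of depth-one seeds with a transcendental coordinate. (`→` restriction; `←`:
  non-depth-one coordinates by the collapse, two algebraic seeds by Lindemann–Weierstrass — the sector landed
  as the registered stub `Summit.Schanuel.Schanuel.Theorems.stub_purityAlgebraic`, re-derived inline here.) This is the kernel-checked form of the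
  crux-triage verdict "costume" (TRIAGE-r1-1/2/3) on which the lead declared the line dead.
* §3 `expOnePiAlgebraicIndependent_of_schanuelTwo` — the crux at `x = (1, πi)` gives the algebraic
  independence of `e` and `π` (registered open statement
  `Literature.NumberTheory.Transcendental.ExpOnePiAlgebraicIndependent`); both coordinates there ARE
  depth-one seeds with `πi` transcendental (`trdeg_adjoin_one_exp_eq_one`, `trdeg_adjoin_piI_exp_eq_one`),
  so the open instance lies inside the residual stub's own hypotheses.
* §4 `schanuelTwo_iff_schanuelRank_two`, `schanuelTwo_iff_royCriterion_two` — the crux is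
  `SchanuelRank 2` (numeral cast) and, by Roy's proved equivalence `Roy2001_iff_holds`, `RoyCriterion 2`.

Sources: Baker 1975 Ch. 1 Thm 1.4 (Hermite–Lindemann, Lindemann–Weierstrass); Roy 2001 (Acta Arith. 97)
§1 + Thm 1; the crux workfiles `Cruxes/SchanuelTwo/{Disproof.lean §5–§6, TriageR1K3.lean §A, Lines/Sketch.lean}`
from which the arguments are adapted (those files are not importable from `Theorems/`).
-/

noncomputable section

open Complex IntermediateField
open Literature.Barriers.Schanuel (trdeg_mono trdeg_adjoin_singleton_le_one
  trdeg_adjoin_union_eq_of_isAlgebraic algebraicIndependent_of_le_trdeg_adjoin)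
open Summit.Schanuel.Schanuel.Theses.RoyCriterion (SchanuelTwo)

namespace Summit.Schanuel.Schanuel.Theorems

/-! ### §1 Hermite–Lindemann floor and collapse -/

/-- **Hermite–Lindemann floor for one point**: if `a ≠ 0` then `1 ≤ trdeg_ℚ ℚ(a, e^a)` — either `a` is
transcendental, or `a` is algebraic and then `e^a` is transcendental (tree theorem
`Literature.NumberTheory.Transcendental.transcendental_exp_holds`). [cite: BakerTNT1975, Ch. 1 Theorem 1.4] -/
theorem schanuelTwo_one_le_trdeg_seed {a : ℂ} (ha : a ≠ 0) :
    (1 : Cardinal) ≤ Algebra.trdeg ℚ ↥(IntermediateField.adjoin ℚ ({a, Complex.exp a} : Set ℂ)) := by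
  obtain ⟨t, htK, ht⟩ : ∃ t : ℂ, t ∈ adjoin ℚ ({a, cexp a} : Set ℂ) ∧ Transcendental ℚ t := by
    by_cases halg : IsAlgebraic ℚ a
    · exact ⟨cexp a, subset_adjoin _ _ (by simp),
        Literature.NumberTheory.Transcendental.transcendental_exp_holds halg ha⟩
    · exact ⟨a, subset_adjoin _ _ (by simp), halg⟩
  haveI : Algebra.Transcendental ℚ (adjoin ℚ ({a, cexp a} : Set ℂ)) :=
    ⟨⟨⟨t, htK⟩, fun h => ht (IntermediateField.isAlgebraic_iff.mp h)⟩⟩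
  exact Cardinal.one_le_iff_pos.mpr (trdeg_pos ℚ _)

/-- `ℚ(x i, e^{x i}) ≤ ℚ(x, e^x)`. [folklore] -/
theorem schanuelTwo_adjoin_seed_le (x : Fin 2 → ℂ) (i : Fin 2) :
    IntermediateField.adjoin ℚ ({x i, Complex.exp (x i)} : Set ℂ) ≤
      IntermediateField.adjoin ℚ (Set.range x ∪ Set.range (Complex.exp ∘ x)) := by
  rw [adjoin_le_iff]
  rintro z (rfl | hz)
  · exact subset_adjoin ℚ _ (Or.inl ⟨i, rfl⟩)
  · rw [Set.mem_singleton_iff.mp hz]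
    exact subset_adjoin ℚ _ (Or.inr ⟨i, rfl⟩)

/-- **Hermite–Lindemann floor for a pair**: every `ℚ`-linearly independent `x : Fin 2 → ℂ` has
`1 ≤ trdeg_ℚ ℚ(x, e^x)` (`x 0 ≠ 0`). [cite: BakerTNT1975, Ch. 1 Theorem 1.4] -/
theorem schanuelTwo_one_le_trdeg (x : Fin 2 → ℂ) (hx : LinearIndependent ℚ x) :
    (1 : Cardinal) ≤ Algebra.trdeg ℚ ↥(IntermediateField.adjoin ℚ (Set.range x ∪ Set.range (Complex.exp ∘ x))) :=
  (schanuelTwo_one_le_trdeg_seed (hx.ne_zero 0)).trans (trdeg_mono (schanuelTwo_adjoin_seed_le x 0))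

/-- In `Cardinal`: from `1 ≤ t`, `2 ≤ t ↔ t ≠ 1`. [folklore] -/
theorem schanuelTwo_two_le_iff_ne_one {t : Cardinal} (h1 : 1 ≤ t) : 2 ≤ t ↔ t ≠ 1 := by
  constructor
  · rintro h rfl
    exact Nat.not_ofNat_le_one h
  · intro hne
    by_contra hlt
    have ht2 : t < 2 := not_le.mp hlt
    have h2al : (2 : Cardinal) < Cardinal.aleph0 := by
      exact_mod_cast Cardinal.natCast_lt_aleph0 (n := 2)
    obtain ⟨n, rfl⟩ := Cardinal.lt_aleph0.1 (ht2.trans h2al)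
    have h1' : 1 ≤ n := by exact_mod_cast h1
    have h2' : n < 2 := by exact_mod_cast ht2
    have h3' : n ≠ 1 := fun hn => hne (by rw [hn]; norm_num)
    omega

/-- **Hermite–Lindemann collapse of the crux**: `SchanuelTwo` says exactly that `trdeg_ℚ ℚ(x, e^x)` is
never `1` for `ℚ`-free `x` — a counterexample has transcendence degree EXACTLY one. [folklore] -/
theorem schanuelTwo_iff_trdeg_ne_one :
    SchanuelTwo ↔ ∀ x : Fin 2 → ℂ, LinearIndependent ℚ x →
      Algebra.trdeg ℚ ↥(IntermediateField.adjoin ℚ (Set.range x ∪ Set.range (Complex.exp ∘ x))) ≠ 1 :=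
  forall₂_congr fun x hx => schanuelTwo_two_le_iff_ne_one (schanuelTwo_one_le_trdeg x hx)

/-! ### §2 The residual stub of line `Sketch` is equivalent to the crux -/

/-- **`SchanuelTwo` ⟺ purity for pairs of depth-one seeds with a transcendental coordinate** (the
registered residual stub `stub_purityTranscendental` of line `Sketch`, spelled out). `→`: restriction.
`←`: let `x` be `ℚ`-free. If some `x i` is not a depth-one seed, then `trdeg ℚ(x i, e^{x i}) ≥ 1`
(Hermite–Lindemann) and `≠ 1`, so `≥ 2`, and `ℚ(x i, e^{x i}) ⊆ ℚ(x, e^x)`. If both are depth-one and both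
algebraic, Lindemann–Weierstrass (tree theorem `algebraicIndependent_exp_holds`). Otherwise the purity hypothesis
applies. Hence the line's `Leans on:` (Hermite–Lindemann, Lindemann–Weierstrass) leave exactly the crux. [folklore] -/
theorem schanuelTwo_iff_seedPurity :
    SchanuelTwo ↔ ∀ x : Fin 2 → ℂ, LinearIndependent ℚ x → (∃ i, Transcendental ℚ (x i)) →
      (∀ i, Algebra.trdeg ℚ ↥(IntermediateField.adjoin ℚ ({x i, Complex.exp (x i)} : Set ℂ)) = 1) →
      (2 : Cardinal) ≤ Algebra.trdeg ℚ ↥(IntermediateField.adjoin ℚ (Set.range x ∪ Set.range (Complex.exp ∘ x))) := by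
  constructor
  · intro hS x hx _ _
    exact hS x hx
  · intro hT x hx
    by_cases hdepth : ∀ i, Algebra.trdeg ℚ ↥(adjoin ℚ ({x i, cexp (x i)} : Set ℂ)) = 1
    · by_cases halg : ∀ i, IsAlgebraic ℚ (x i)
      · -- the (E,E) sector: Lindemann–Weierstrass (landed separately as the registered stub
        -- `Summit.Schanuel.Schanuel.Theorems.stub_purityAlgebraic`, Theorems/RoyCriterionSchanuelTwoStubPurityAlgebraic.lean)
        have hind : AlgebraicIndependent ℚ (fun i => cexp (x i)) :=
          Literature.NumberTheory.Transcendental.algebraicIndependent_exp_holds x halg hx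
        let y : Fin 2 → ↥(adjoin ℚ (Set.range x ∪ Set.range (Complex.exp ∘ x))) :=
          fun i => ⟨cexp (x i), subset_adjoin ℚ _ (Or.inr ⟨i, rfl⟩)⟩
        have hy : AlgebraicIndependent ℚ y :=
          AlgebraicIndependent.of_comp (adjoin ℚ (Set.range x ∪ Set.range (Complex.exp ∘ x))).val hind
        simpa using hy.cardinalMk_le_trdeg
      · push Not at halg
        obtain ⟨i, hi⟩ := halg
        exact hT x hx ⟨i, hi⟩ hdepth
    · push Not at hdepth
      obtain ⟨i, hi⟩ := hdepth
      have h2 : (2 : Cardinal) ≤ Algebra.trdeg ℚ ↥(adjoin ℚ ({x i, cexp (x i)} : Set ℂ)) :=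
        (schanuelTwo_two_le_iff_ne_one (schanuelTwo_one_le_trdeg_seed (hx.ne_zero i))).mpr hi
      exact h2.trans (trdeg_mono (schanuelTwo_adjoin_seed_le x i))

/-! ### §3 The flagship open instance lies inside the residual stub: `x = (1, πi)` -/

/-- `trdeg_ℚ ℚ(a, e^a) ≤ 1` if `e^a` is algebraic (`ℚ(a)(e^a)` is algebraic over `ℚ(a)`). [folklore] -/
theorem trdeg_adjoin_seed_le_one_of_isAlgebraic_exp {a : ℂ} (h : IsAlgebraic ℚ (cexp a)) :
    Algebra.trdeg ℚ ↥(IntermediateField.adjoin ℚ ({a, Complex.exp a} : Set ℂ)) ≤ 1 := by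
  have hsplit : ({a, cexp a} : Set ℂ) = {a} ∪ {cexp a} := by
    ext z; simp [or_comm]
  have heq : Algebra.trdeg ℚ ↥(adjoin ℚ ({a, cexp a} : Set ℂ)) =
      Algebra.trdeg ℚ ↥(adjoin ℚ ({a} : Set ℂ)) := by
    rw [hsplit]
    exact trdeg_adjoin_union_eq_of_isAlgebraic {a} {cexp a}
      (fun z hz => by rwa [Set.mem_singleton_iff.mp hz])
  rw [heq]
  exact trdeg_adjoin_singleton_le_one a

/-- `trdeg_ℚ ℚ(a, e^a) ≤ 1` if `a` is algebraic. [folklore] -/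
theorem trdeg_adjoin_seed_le_one_of_isAlgebraic {a : ℂ} (h : IsAlgebraic ℚ a) :
    Algebra.trdeg ℚ ↥(IntermediateField.adjoin ℚ ({a, Complex.exp a} : Set ℂ)) ≤ 1 := by
  have hsplit : ({a, cexp a} : Set ℂ) = {cexp a} ∪ {a} := by
    ext z; simp
  have heq : Algebra.trdeg ℚ ↥(adjoin ℚ ({a, cexp a} : Set ℂ)) =
      Algebra.trdeg ℚ ↥(adjoin ℚ ({cexp a} : Set ℂ)) := by
    rw [hsplit]
    exact trdeg_adjoin_union_eq_of_isAlgebraic {cexp a} {a}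
      (fun z hz => by rwa [Set.mem_singleton_iff.mp hz])
  rw [heq]
  exact trdeg_adjoin_singleton_le_one (cexp a)

/-- `1` is a depth-one seed: `trdeg_ℚ ℚ(1, e) = 1`. [cite: BakerTNT1975, Ch. 1 Theorem 1.2] -/
theorem trdeg_adjoin_one_exp_eq_one :
    Algebra.trdeg ℚ ↥(IntermediateField.adjoin ℚ ({(1 : ℂ), Complex.exp 1} : Set ℂ)) = 1 :=
  le_antisymm (trdeg_adjoin_seed_le_one_of_isAlgebraic isAlgebraic_one)
    (schanuelTwo_one_le_trdeg_seed one_ne_zero)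

/-- `πi` is a depth-one seed: `trdeg_ℚ ℚ(πi, e^{πi} = −1) = 1`. [cite: BakerTNT1975, Ch. 1 Theorem 1.3] -/
theorem trdeg_adjoin_piI_exp_eq_one :
    Algebra.trdeg ℚ ↥(IntermediateField.adjoin ℚ
      ({(Real.pi : ℂ) * I, Complex.exp ((Real.pi : ℂ) * I)} : Set ℂ)) = 1 := by
  have hne : (Real.pi : ℂ) * I ≠ 0 :=
    mul_ne_zero (by exact_mod_cast Real.pi_ne_zero) Complex.I_ne_zero
  refine le_antisymm (trdeg_adjoin_seed_le_one_of_isAlgebraic_exp ?_) (schanuelTwo_one_le_trdeg_seed hne)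
  rw [Complex.exp_pi_mul_I]
  simpa using isAlgebraic_algebraMap (R := ℚ) (A := ℂ) (-1)

/-- `πi` is transcendental over `ℚ` (`π` is — tree theorem `transcendental_pi_holds` — and `i` is
algebraic). [cite: BakerTNT1975, Ch. 1 Theorem 1.3] -/
theorem transcendental_piI : Transcendental ℚ ((Real.pi : ℂ) * I) := by
  intro halg
  have hpi : IsAlgebraic ℚ ((Real.pi : ℂ) * I * (-I)) :=
    halg.mul (Literature.Barriers.Schanuel.isAlgebraic_I.neg)
  have : (Real.pi : ℂ) * I * (-I) = Real.pi := by
    rw [mul_assoc, mul_neg, Complex.I_mul_I, neg_neg, mul_one]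
  rw [this] at hpi
  exact Literature.NumberTheory.Transcendental.transcendental_pi_holds
    ((isAlgebraic_algebraMap_iff (Complex.ofReal_injective)).mp (by simpa using hpi))

/-- `2 ≤ trdeg_ℚ ℚ(1, πi, e, e^{πi})` implies the algebraic independence of `e` and `π`
(`ℚ(1, πi, e, −1) ⊆ ℚ(e, π, i)`, `i` algebraic; transfer to `ℝ`). [cite: BakerTNT1975, Ch. 12 p. 120] -/
theorem expOnePiAlgebraicIndependent_of_two_le_trdeg
    (h2 : (2 : Cardinal) ≤ Algebra.trdeg ℚ ↥(IntermediateField.adjoin ℚ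
      (Set.range ![(1 : ℂ), (Real.pi : ℂ) * I] ∪ Set.range (Complex.exp ∘ ![(1 : ℂ), (Real.pi : ℂ) * I])))) :
    Literature.NumberTheory.Transcendental.ExpOnePiAlgebraicIndependent := by
  set l : Fin 2 → ℂ := fun i => ((![Real.exp 1, Real.pi] i : ℝ) : ℂ) with hldef
  have he : ((Real.exp 1 : ℝ) : ℂ) ∈ adjoin ℚ (Set.range l ∪ {I}) :=
    subset_adjoin ℚ _ (Or.inl ⟨0, by simp [hldef]⟩)
  have hpi : (Real.pi : ℂ) ∈ adjoin ℚ (Set.range l ∪ {I}) :=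
    subset_adjoin ℚ _ (Or.inl ⟨1, by simp [hldef]⟩)
  have hI : I ∈ adjoin ℚ (Set.range l ∪ {I}) := subset_adjoin ℚ _ (Or.inr rfl)
  have hle : adjoin ℚ (Set.range ![(1 : ℂ), (Real.pi : ℂ) * I] ∪
      Set.range (Complex.exp ∘ ![(1 : ℂ), (Real.pi : ℂ) * I])) ≤ adjoin ℚ (Set.range l ∪ {I}) := by
    rw [adjoin_le_iff]
    rintro w (⟨i, rfl⟩ | ⟨i, rfl⟩) <;> fin_cases i
    · simp
    · simpa using mul_mem hpi hI
    · simp only [Fin.zero_eta, Fin.isValue, Function.comp_apply, Matrix.cons_val_zero, SetLike.mem_coe]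
      rw [show cexp 1 = ((Real.exp 1 : ℝ) : ℂ) by rw [Complex.ofReal_exp]; simp]
      exact he
    · simp [Complex.exp_pi_mul_I]
  have h2' : ((2 : ℕ) : Cardinal) ≤ Algebra.trdeg ℚ (adjoin ℚ (Set.range l)) := by
    have h := (h2.trans (trdeg_mono hle)).trans_eq
      (trdeg_adjoin_union_eq_of_isAlgebraic (Set.range l) {I}
        (fun x hx => by
          rw [Set.mem_singleton_iff.mp hx]
          exact Literature.Barriers.Schanuel.isAlgebraic_I))
    exact_mod_cast h
  have hC : AlgebraicIndependent ℚ l := algebraicIndependent_of_le_trdeg_adjoin l h2'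
  exact Literature.Barriers.Schanuel.algebraicIndependent_real_of_complex _ hC

/-- **`SchanuelTwo ⟹ e and π are algebraically independent`** (the rank-2 crux alone suffices; cf.
`Literature.Barriers.Schanuel.expOnePiAlgebraicIndependent_of_schanuel`, which assumes all ranks). OPEN as
a statement; an algebraic relation between `e` and `π` would refute the crux. [cite: BakerTNT1975, Ch. 12 p. 120] -/
theorem expOnePiAlgebraicIndependent_of_schanuelTwo (hS : SchanuelTwo) :
    Literature.NumberTheory.Transcendental.ExpOnePiAlgebraicIndependent :=
  expOnePiAlgebraicIndependent_of_two_le_trdeg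
    (hS _ Literature.Barriers.Schanuel.linearIndependent_one_piI)

/-- **The open instance lies inside the residual stub**: purity for pairs of depth-one seeds with a
transcendental coordinate, applied VERBATIM at `x = (1, πi)` (both depth-one: `trdeg_adjoin_one_exp_eq_one`,
`trdeg_adjoin_piI_exp_eq_one`; `πi` transcendental), yields the algebraic independence of `e` and `π`. So no
proof of the stub can avoid this open problem (Lang 1966; Waldschmidt 2000 §1.4). [folklore] -/
theorem expOnePiAlgebraicIndependent_of_seedPurity
    (hT : ∀ x : Fin 2 → ℂ, LinearIndependent ℚ x → (∃ i, Transcendental ℚ (x i)) →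
      (∀ i, Algebra.trdeg ℚ ↥(IntermediateField.adjoin ℚ ({x i, Complex.exp (x i)} : Set ℂ)) = 1) →
      (2 : Cardinal) ≤ Algebra.trdeg ℚ ↥(IntermediateField.adjoin ℚ (Set.range x ∪ Set.range (Complex.exp ∘ x)))) :
    Literature.NumberTheory.Transcendental.ExpOnePiAlgebraicIndependent := by
  refine expOnePiAlgebraicIndependent_of_two_le_trdeg
    (hT _ Literature.Barriers.Schanuel.linearIndependent_one_piI ⟨1, ?_⟩ fun i => ?_)
  · simpa using transcendental_piI
  · fin_cases i
    · exact trdeg_adjoin_one_exp_eq_one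
    · exact trdeg_adjoin_piI_exp_eq_one

/-! ### §4 Equivalent dress: `SchanuelRank 2` and `RoyCriterion 2` -/

/-- `SchanuelTwo` is `SchanuelRank 2` of `Literature/NumberTheory/Transcendental/RoyCriterion.lean` (the
cast `((2 : ℕ) : Cardinal) = 2` only). [cite: Roy2001, Conjecture 1] -/
theorem schanuelTwo_iff_schanuelRank_two :
    SchanuelTwo ↔ Literature.NumberTheory.Transcendental.SchanuelRank 2 := by
  unfold Summit.Schanuel.Schanuel.Theses.RoyCriterion.SchanuelTwo
    Literature.NumberTheory.Transcendental.SchanuelRank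
  simp

/-- **`SchanuelTwo ↔ RoyCriterion 2`** (Roy 2001, Conjecture 2 in rank 2 — small values of `D^k P_N` at the
points `(m₁y₁ + m₂y₂, α₁^{m₁}α₂^{m₂})` force `trdeg ℚ(y, α) ≥ 2`), by the tree's PROVED equivalence
`Literature.NumberTheory.Transcendental.Roy2001_iff_holds`. [cite: Roy2001, Conjecture 2 and Theorem 1] -/
theorem schanuelTwo_iff_royCriterion_two :
    SchanuelTwo ↔ Literature.NumberTheory.Transcendental.RoyCriterion 2 :=
  schanuelTwo_iff_schanuelRank_two.trans
    (Literature.NumberTheory.Transcendental.Roy2001_iff_holds 2).symm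

end Summit.Schanuel.Schanuel.Theorems

end
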